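import Summits.QuantumFields.GaugeBoot.DiagonalRPTorusOddStaircasePrep
import Summits.QuantumFields.GaugeBoot.DiagonalRPTorusResampling
import HarnessLib

/-!
# The reflection-positivity integral against the staircase witness on the odd two-torus:
`∫ Φ_odd = c^L · P`, `P > 0` (gauge-boot, L3(θ) gauge-invariant sector at `β < 0`, 2b/3)

HONEST FRAMING (cell `pub-gaugeboot`, page 1 of every file): the venture produces certified bounds
on lattice expectations at stated coupling, gauge group, dimension and torus size; NOT a mass gap,
NOT a continuum limit, NOT a string tension; NOT Yang–Mills-summit-bearing (barriers
`FixedCouplingUltralocality`, `PerturbativeInvisibility`). The computation behind the NEGATIVE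
structural result `DiagonalRPTorusOddGaugeInvariantNegative.lean`; no number is certified.

## Content (odd two-torus files `DiagonalRPTorusOdd*`, `DiagonalRPTorusOddStaircase{,Prep}`)

Let `L ≥ 5`, `i ≠ j`, `ρ` continuous, `w = w_β = exp(β Re tr ρ)` the one-link Wilson weight with
`wAvg ρ w = c • 1` (scalar commutant), `F = stairWitness`. By `rpIntegrand_eq_odd` the RP integrand
`e^{-βS}(ΘF)‾F` is `e^{-βN#P} Φ_odd` with
`Φ_odd = tr ρ(stairC L) · conj tr ρ(stairD L) · E₀ · A · (A∘Θ)`, `E₀ = ∏_{t<L} w(C_t D_t⁻¹)` the mirror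
crossing weight (`mirrorE_eq_prod`), `A = layerW` the far-layer weight.

* ★ `integral_stage` — resampling the link `(dg k, j)` (`DiagRPSUN.integral_pi_update_of_forall`)
  turns `conj tr ρ(stairM k L) · w(C_k D_k⁻¹)` into `c · conj tr ρ(stairM (k+1) L)` under the
  integral, for every continuous spectator not reading that link; ★ `integral_stages` — all `L`
  stages by induction.
* ★★ **`integral_rpPhiOdd_stairWitness_eq`** — `∫ Φ_odd(F) d(∏ Haar) = c^L · P` with
  `P = ∫ |tr ρ(stairC L U)|² A(U) A(ΘU) > 0` (`N ≥ 1`; `integral_final_pos`).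

Elementary (Fubini, invariance of Haar measure); [folklore] tools only.
-/

open MeasureTheory Complex Finset Function
open scoped ComplexOrder

namespace Summit.QuantumFields.GaugeBoot

open Literature.MathematicalPhysics.QuantumFieldTheory
open Literature.RepresentationTheory.CompactGroups

noncomputable section

namespace DiagRPTwo

/-! ## The stages of the mirror integration -/

section Stages

variable {L N : ℕ} [NeZero L] {G : Type*} [Group G] [TopologicalSpace G] [IsTopologicalGroup G]
  [CompactSpace G] [MeasurableSpace G] [BorelSpace G] [SecondCountableTopology G]
  (ρ : G →* Matrix (Fin N) (Fin N) ℂ) {i j : Fin 2}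

/-- ★ **One stage**: resampling the mirror link `(dg k, j)` (`k < L`, `L ≥ 2`). For every
continuous spectator `R` not reading that link,
`∫ tr ρ(stairC L) conj tr ρ(stairM k L) w(C_k D_k⁻¹) R = c ∫ tr ρ(stairC L) conj tr ρ(stairM (k+1) L) R`. -/
theorem integral_stage (h2 : 2 ≤ L) (hij : i ≠ j) (hρ : Continuous ρ) {w : G → ℝ} (hw : Continuous w)
    {c : ℝ}
    (hc : TwistedSlab.wAvg ρ w = ((c : ℂ)) • (1 : Matrix (Fin N) (Fin N) ℂ)) {k : ℕ} (hk : k < L)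
    {R : GaugeConfig 2 L G → ℂ} (hR : Continuous R)
    (hRu : ∀ (U : GaugeConfig 2 L G) (s : G), R (Function.update U (dg k, j) s) = R U) :
    ∫ U, (ρ (stairC i j L U)).trace * (starRingEnd ℂ) ((ρ (stairM i j k L U)).trace) *
        (w (cT i j U (dg k) * (dT i j U (dg k))⁻¹) : ℂ) * R U ∂(linkMeasure L G) =
      (c : ℂ) * ∫ U, (ρ (stairC i j L U)).trace * (starRingEnd ℂ) ((ρ (stairM i j (k + 1) L U)).trace) *
        R U ∂(linkMeasure L G) := by
  haveI : IsProbabilityMeasure (haarProbability G) := CompactGroup.isProbabilityMeasure_haarMeasure_top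
  have hcontk : Continuous fun U : GaugeConfig 2 L G => (ρ (stairC i j L U)).trace *
      (starRingEnd ℂ) ((ρ (stairM i j k L U)).trace) *
      (w (cT i j U (dg k) * (dT i j U (dg k))⁻¹) : ℂ) * R U :=
    (((hρ.matrix_trace.comp (continuous_stairC L)).mul
      (Complex.continuous_conj.comp (hρ.matrix_trace.comp (continuous_stairM k L)))).mul
      (Complex.continuous_ofReal.comp (hw.comp ((continuous_cT _).mul (continuous_dT _).inv)))).mul hR
  rw [← integral_const_mul]
  refine DiagRPSUN.integral_pi_update_of_forall (haarProbability G) ((dg k, j) : Edge 2 L)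
    (hcontk.integrable_of_hasCompactSupport (HasCompactSupport.of_compactSpace _)) fun U => ?_
  have hM1' := (stairM_update_dgj (i := i) (j := j) h2 hij hk U 1).2.2
  -- the integrand after the update
  have hupd : ∀ s : G,
      (ρ (stairC i j L (Function.update U (dg k, j) s))).trace *
        (starRingEnd ℂ) ((ρ (stairM i j k L (Function.update U (dg k, j) s))).trace) *
        (w (cT i j (Function.update U (dg k, j) s) (dg k) *
          (dT i j (Function.update U (dg k, j) s) (dg k))⁻¹) : ℂ) * R (Function.update U (dg k, j) s) =
      (ρ (stairC i j L U)).trace * R U *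
        ((starRingEnd ℂ) ((ρ (stairC i j k U * (s * U ((dg k : Site 2 L).shift j, i)) *
          tailD i j k L U)).trace) *
          (w (cT i j U (dg k) * (s * U ((dg k : Site 2 L).shift j, i))⁻¹) : ℂ)) := by
    intro s
    obtain ⟨hM, -, -⟩ := stairM_update_dgj (i := i) (j := j) h2 hij hk U s
    rw [stairC_update_dgj h2 hij, hM, cT_update_dgj h2 hij, dT_update_dgj_self hij, hRu]
    ring
  simp_rw [hupd]
  rw [integral_const_mul, integral_conj_trace_mul_weight ρ hρ hw hc, hM1']
  ring

omit [NeZero L] [TopologicalSpace G] [IsTopologicalGroup G] [CompactSpace G] [MeasurableSpace G]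
  [BorelSpace G] [SecondCountableTopology G] in
/-- The `k`-th mirror weight `∏_{k ≤ t < L} w(C_t D_t⁻¹)` splits off its first factor. -/
theorem prod_Ico_weight_succ {w : G → ℝ} {k : ℕ} (hk : k < L) (U : GaugeConfig 2 L G) :
    (∏ t ∈ Finset.Ico k L, w (cT i j U (dg t) * (dT i j U (dg t))⁻¹)) =
      w (cT i j U (dg k) * (dT i j U (dg k))⁻¹) *
        ∏ t ∈ Finset.Ico (k + 1) L, w (cT i j U (dg t) * (dT i j U (dg t))⁻¹) :=
  Finset.prod_eq_prod_Ico_succ_bot hk _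

omit [TopologicalSpace G] [IsTopologicalGroup G] [CompactSpace G] [MeasurableSpace G] [BorelSpace G]
  [SecondCountableTopology G] in
/-- The later mirror weights do not read the link `(dg k, j)`. -/
theorem prod_Ico_weight_update_dgj (hij : i ≠ j) (h2 : 2 ≤ L) {w : G → ℝ} {k : ℕ} (hk : k < L)
    (U : GaugeConfig 2 L G) (s : G) :
    (∏ t ∈ Finset.Ico (k + 1) L, w (cT i j (Function.update U (dg k, j) s) (dg t) *
        (dT i j (Function.update U (dg k, j) s) (dg t))⁻¹)) =
      ∏ t ∈ Finset.Ico (k + 1) L, w (cT i j U (dg t) * (dT i j U (dg t))⁻¹) := by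
  refine Finset.prod_congr rfl fun t ht => ?_
  rw [Finset.mem_Ico] at ht
  rw [cT_update_dgj h2 hij, dT_update_dgj_of_ne hij U hk ht.2 (by omega)]

/-- ★★ **All stages**: for `k ≤ L`,
`∫ tr ρ(stairC L) conj tr ρ(stairM k L) (∏_{k≤t<L} w(C_t D_t⁻¹)) A (A∘Θ)
  = c^{L-k} ∫ |tr ρ(stairC L)|² A (A∘Θ)` (`L ≥ 5`). -/
theorem integral_stages (h5 : 5 ≤ L) (hij : i ≠ j) (hρ : Continuous ρ) {β : ℝ} {c : ℝ}
    (hc : TwistedSlab.wAvg ρ (TwistedSlab.wilsonWeight ρ β) = ((c : ℂ)) • (1 : Matrix (Fin N) (Fin N) ℂ))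
    {k : ℕ} (hk : k ≤ L) :
    ∫ U, (ρ (stairC i j L U)).trace * (starRingEnd ℂ) ((ρ (stairM i j k L U)).trace) *
        ((∏ t ∈ Finset.Ico k L, TwistedSlab.wilsonWeight ρ β (cT i j U (dg t) * (dT i j U (dg t))⁻¹) : ℝ) : ℂ) *
        ((layerW ρ i j β U : ℂ) * (layerW ρ i j β (configDiagSwap i j U) : ℂ)) ∂(linkMeasure L G) =
      (c : ℂ) ^ (L - k) * ∫ U, (ρ (stairC i j L U)).trace * (starRingEnd ℂ) ((ρ (stairC i j L U)).trace) *
        ((layerW ρ i j β U : ℂ) * (layerW ρ i j β (configDiagSwap i j U) : ℂ)) ∂(linkMeasure L G) := by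
  have h2 : 2 ≤ L := by omega
  have hw := TwistedSlab.continuous_wilsonWeight ρ hρ β
  have hA : Continuous fun U : GaugeConfig 2 L G =>
      (layerW ρ i j β U : ℂ) * (layerW ρ i j β (configDiagSwap i j U) : ℂ) :=
    (Complex.continuous_ofReal.comp (continuous_layerW ρ hρ β)).mul
      (Complex.continuous_ofReal.comp ((continuous_layerW ρ hρ β).comp continuous_configDiagSwap'))
  -- the statement for `k = L - m`, by induction on `m`
  suffices h : ∀ m, m ≤ L →
      ∫ U, (ρ (stairC i j L U)).trace * (starRingEnd ℂ) ((ρ (stairM i j (L - m) L U)).trace) *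
        ((∏ t ∈ Finset.Ico (L - m) L,
          TwistedSlab.wilsonWeight ρ β (cT i j U (dg t) * (dT i j U (dg t))⁻¹) : ℝ) : ℂ) *
        ((layerW ρ i j β U : ℂ) * (layerW ρ i j β (configDiagSwap i j U) : ℂ)) ∂(linkMeasure L G) =
      (c : ℂ) ^ m * ∫ U, (ρ (stairC i j L U)).trace * (starRingEnd ℂ) ((ρ (stairC i j L U)).trace) *
        ((layerW ρ i j β U : ℂ) * (layerW ρ i j β (configDiagSwap i j U) : ℂ)) ∂(linkMeasure L G) by
    have := h (L - k) (Nat.sub_le L k)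
    rwa [Nat.sub_sub_self hk] at this
  intro m hm
  induction m with
  | zero =>
    simp only [Nat.sub_zero, pow_zero, one_mul, Finset.Ico_self, Finset.prod_empty,
      Complex.ofReal_one, mul_one, stairM_of_le le_rfl]
  | succ m ih =>
    have hkL : L - (m + 1) < L := by omega
    have hk1 : L - (m + 1) + 1 = L - m := by omega
    -- split off the first weight and resample its link
    have hstep := integral_stage ρ h2 hij hρ hw hc hkL
      (R := fun U => ((∏ t ∈ Finset.Ico (L - (m + 1) + 1) L,
          TwistedSlab.wilsonWeight ρ β (cT i j U (dg t) * (dT i j U (dg t))⁻¹) : ℝ) : ℂ) *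
        ((layerW ρ i j β U : ℂ) * (layerW ρ i j β (configDiagSwap i j U) : ℂ)))
      ((Complex.continuous_ofReal.comp (continuous_finsetProd _ fun t _ =>
          hw.comp ((continuous_cT _).mul (continuous_dT _).inv))).mul hA)
      (fun U s => by
        rw [prod_Ico_weight_update_dgj hij h2 hkL, layerW_update_dgj ρ h5 hij,
          layerW_configDiagSwap_update_dgj ρ h5 hij])
    have hlhs : ∀ U : GaugeConfig 2 L G,
        (ρ (stairC i j L U)).trace * (starRingEnd ℂ) ((ρ (stairM i j (L - (m + 1)) L U)).trace) *
          ((∏ t ∈ Finset.Ico (L - (m + 1)) L,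
            TwistedSlab.wilsonWeight ρ β (cT i j U (dg t) * (dT i j U (dg t))⁻¹) : ℝ) : ℂ) *
          ((layerW ρ i j β U : ℂ) * (layerW ρ i j β (configDiagSwap i j U) : ℂ)) =
        (ρ (stairC i j L U)).trace * (starRingEnd ℂ) ((ρ (stairM i j (L - (m + 1)) L U)).trace) *
          (TwistedSlab.wilsonWeight ρ β (cT i j U (dg (L - (m + 1))) * (dT i j U (dg (L - (m + 1))))⁻¹) : ℂ) *
          (((∏ t ∈ Finset.Ico (L - (m + 1) + 1) L,
            TwistedSlab.wilsonWeight ρ β (cT i j U (dg t) * (dT i j U (dg t))⁻¹) : ℝ) : ℂ) *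
          ((layerW ρ i j β U : ℂ) * (layerW ρ i j β (configDiagSwap i j U) : ℂ))) := by
      intro U
      rw [prod_Ico_weight_succ hkL, Complex.ofReal_mul]
      ring
    simp_rw [hlhs]
    rw [hstep, hk1, pow_succ, mul_comm ((c : ℂ) ^ m), mul_assoc, ← ih (by omega)]
    congr 1
    refine integral_congr_ae (ae_of_all _ fun U => ?_)
    ring

end Stages

/-! ## The value of the RP integral against the witness -/

section Value

variable {L N : ℕ} [NeZero L] {G : Type*} [Group G] [TopologicalSpace G] [IsTopologicalGroup G]
  [CompactSpace G] [MeasurableSpace G] [BorelSpace G] [SecondCountableTopology G]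
  (ρ : G →* Matrix (Fin N) (Fin N) ℂ) {i j : Fin 2}

omit [TopologicalSpace G] [IsTopologicalGroup G] [CompactSpace G] [MeasurableSpace G] [BorelSpace G]
  [SecondCountableTopology G] in
/-- The mirror crossing weight is the product of the one-plaquette weights along the mirror. -/
theorem mirrorE_eq_prod (hij : i ≠ j) (β : ℝ) (U : GaugeConfig 2 L G) :
    mirrorE ρ i j β U =
      ∏ t ∈ Finset.Ico 0 L, TwistedSlab.wilsonWeight ρ β (cT i j U (dg t) * (dT i j U (dg t))⁻¹) := by
  rw [mirrorE, sum_S0_eq_sum_range hij, Finset.mul_sum, Real.exp_sum, Finset.range_eq_Ico]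
  rfl

omit [TopologicalSpace G] [IsTopologicalGroup G] [CompactSpace G] [MeasurableSpace G] [BorelSpace G]
  [SecondCountableTopology G] in
/-- `Φ_odd` for the staircase witness, as the stage-`0` integrand. -/
theorem rpPhiOdd_stairWitness (hij : i ≠ j) (β : ℝ) (U : GaugeConfig 2 L G) :
    rpPhiOdd ρ i j β (stairWitness ρ i j β) U =
      (ρ (stairC i j L U)).trace * (starRingEnd ℂ) ((ρ (stairM i j 0 L U)).trace) *
        ((∏ t ∈ Finset.Ico 0 L, TwistedSlab.wilsonWeight ρ β (cT i j U (dg t) * (dT i j U (dg t))⁻¹) : ℝ) : ℂ) *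
        ((layerW ρ i j β U : ℂ) * (layerW ρ i j β (configDiagSwap i j U) : ℂ)) := by
  rw [rpPhiOdd, gObs_stairWitness, gObs_stairWitness, stairC_configDiagSwap, stairM_zero_left,
    mirrorE_eq_prod ρ hij]
  ring

omit [TopologicalSpace G] [IsTopologicalGroup G] [CompactSpace G] [MeasurableSpace G] [BorelSpace G]
  [SecondCountableTopology G] in
/-- The final integrand is the real non-negative `|tr ρ(stairC L U)|² A(U) A(ΘU)`. -/
theorem final_integrand_eq (β : ℝ) (U : GaugeConfig 2 L G) :
    (ρ (stairC i j L U)).trace * (starRingEnd ℂ) ((ρ (stairC i j L U)).trace) *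
        ((layerW ρ i j β U : ℂ) * (layerW ρ i j β (configDiagSwap i j U) : ℂ)) =
      ((Complex.normSq ((ρ (stairC i j L U)).trace) * (layerW ρ i j β U *
        layerW ρ i j β (configDiagSwap i j U)) : ℝ) : ℂ) := by
  rw [Complex.mul_conj]; push_cast; ring

/-- ★ **`P = ∫ |tr ρ(stairC L U)|² A(U) A(ΘU) > 0`** (`N ≥ 1`: the integrand is continuous,
non-negative and equals `N² A(1)²… > 0` at `U = 1`; product Haar measure charges open sets). -/
theorem integral_final_pos (hρ : Continuous ρ) (hN : 1 ≤ N) (β : ℝ) :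
    0 < ∫ U, Complex.normSq ((ρ (stairC i j L U)).trace) *
      (layerW ρ i j β U * layerW ρ i j β (configDiagSwap i j U)) ∂(linkMeasure L G) := by
  haveI : IsProbabilityMeasure (haarProbability G) := CompactGroup.isProbabilityMeasure_haarMeasure_top
  haveI : (haarProbability G).IsOpenPosMeasure := by unfold haarProbability; infer_instance
  haveI : (linkMeasure L G).IsOpenPosMeasure := by unfold linkMeasure; infer_instance
  have hcont : Continuous fun U : GaugeConfig 2 L G => Complex.normSq ((ρ (stairC i j L U)).trace) *
      (layerW ρ i j β U * layerW ρ i j β (configDiagSwap i j U)) :=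
    (Complex.continuous_normSq.comp (hρ.matrix_trace.comp (continuous_stairC L))).mul
      ((continuous_layerW ρ hρ β).mul ((continuous_layerW ρ hρ β).comp continuous_configDiagSwap'))
  refine hcont.integral_pos_of_hasCompactSupport_nonneg_nonzero (HasCompactSupport.of_compactSpace _)
    (fun U => mul_nonneg (Complex.normSq_nonneg _)
      (mul_nonneg (layerW_pos ρ β U).le (layerW_pos ρ β _).le)) (x := 1) ?_
  have h1 : stairC i j L (1 : GaugeConfig 2 L G) = 1 := by
    have : ∀ n, stairC i j n (1 : GaugeConfig 2 L G) = 1 := by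
      intro n
      induction n with
      | zero => simp
      | succ n ih => rw [stairC_succ, ih, cT]; simp
    exact this L
  rw [h1, map_one, Matrix.trace_one, Fintype.card_fin]
  refine mul_ne_zero ?_ (mul_pos (layerW_pos ρ β _) (layerW_pos ρ β _)).ne'
  rw [Complex.normSq_natCast]
  have : (0 : ℝ) < N := by exact_mod_cast hN
  positivity

/-- ★★ **The RP integral against the staircase witness**: `L ≥ 5`, `i ≠ j`, `ρ` continuous with
`N ≥ 1`, `wAvg ρ w_β = c • 1`. Then `∫ Φ_odd(F) d(∏ Haar) = c^L · P` with `P > 0`. -/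
theorem integral_rpPhiOdd_stairWitness_eq (h5 : 5 ≤ L) (hij : i ≠ j) (hρ : Continuous ρ) (hN : 1 ≤ N)
    {β : ℝ} {c : ℝ}
    (hc : TwistedSlab.wAvg ρ (TwistedSlab.wilsonWeight ρ β) = ((c : ℂ)) • (1 : Matrix (Fin N) (Fin N) ℂ)) :
    ∃ P : ℝ, 0 < P ∧
      ∫ U, rpPhiOdd ρ i j β (stairWitness ρ i j β) U ∂(linkMeasure L G) = ((c ^ L * P : ℝ) : ℂ) := by
  refine ⟨_, integral_final_pos (L := L) (i := i) (j := j) ρ hρ hN β, ?_⟩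
  simp_rw [rpPhiOdd_stairWitness (L := L) ρ hij β]
  rw [integral_stages (L := L) ρ h5 hij hρ hc (Nat.zero_le L), Nat.sub_zero]
  simp_rw [final_integrand_eq (L := L) (i := i) (j := j) ρ β]
  rw [integral_complex_ofReal]
  push_cast
  ring

end Value

end DiagRPTwo

end

end Summit.QuantumFields.GaugeBoot
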